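import Summits.CriticalPhenomena.SAWScalingLimit.Theorems.AnnularMassDecay.Negative.LoadBearing
import Literature.Probability.RandomPlanarGeometry.SAWBridges

/-!
# `AnnularMassDecay` (crux stmt-CriticalPhenomena-4729), negative lane: the half-plane generating function diverges at `x_c`

Standing disprover (cdisprove), cycle 2.  The crux asks that the interior vertices of the counted
walks lie in the OPEN ANNULUS `r < |· - z| < R`.  Here we drop the inner half of that clause (the
interior may enter the target disc `|· - z| ≤ r`; only the outer confinement `|· - z| < R` and the
endpoint clause are kept) and prove the resulting statement FALSE:

* `halfPlanePartialSum_unbounded` — the partial sums `H_K = Σ_{k ≤ K} h_k x_c^k` of the half-plane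
  generating function at `x_c` are unbounded (Madras–Slade Cor. 3.1.8, first half: `c_n x_c^n ≥ 1`
  by `μ^n ≤ c_n`, and `c_n ≤ Σ_m h_{m+1} h_{n-m}` by cutting at the last minimum of the first
  coordinate, in tree as `SAW.Zd.count_le_sum_halfSpaceCount`);
* the geometric half (hung half-plane walks are counted by the variant, hence it is false) is the
  companion file `AvoidInner.lean`, which imports this one.

Moral for provers: without "the interior avoids the target disc" the family is no longer
prefix-free / bridge-like and inherits the divergence `H(x_c) = ∞`; any proof of the crux must use
the first-entrance structure of the endpoint. [folklore]
-/

namespace Summit.CriticalPhenomena.SAWScalingLimit.Theorems.AnnularMassDecay.Negative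

open Literature.Probability.RandomPlanarGeometry Literature.Probability.LatticeModels Filter Topology
open scoped BigOperators Classical

noncomputable section

/-! ### The half-plane generating function diverges at `x_c` -/

/-- `H_K := Σ_{k ≤ K} h_k x_c^k`, partial sums of the half-plane generating function at `x_c`
(`h_k = SAW.Zd.halfSpaceCount 2 k`). [cite: MadrasSlade1993, Definition 3.1.2] -/
def halfPlanePartialSum (K : ℕ) : ℝ :=
  ∑ k ∈ Finset.range (K + 1), (SAW.Zd.halfSpaceCount 2 k : ℝ) * SAW.criticalFugacity ^ k

/-- `H_K ≥ 0`. [folklore] -/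
theorem halfPlanePartialSum_nonneg (K : ℕ) : 0 ≤ halfPlanePartialSum K :=
  Finset.sum_nonneg fun _ _ => mul_nonneg (Nat.cast_nonneg _) (pow_nonneg criticalFugacity_pos.le _)

/-- `H` is monotone in `K`. [folklore] -/
theorem halfPlanePartialSum_mono {K L : ℕ} (h : K ≤ L) :
    halfPlanePartialSum K ≤ halfPlanePartialSum L :=
  Finset.sum_le_sum_of_subset_of_nonneg (Finset.range_mono (Nat.succ_le_succ h))
    fun _ _ _ => mul_nonneg (Nat.cast_nonneg _) (pow_nonneg criticalFugacity_pos.le _)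

/-- `c_n x_c^n ≥ 1` (`μ^n ≤ c_n`, `x_c = 1/μ`). [cite: MadrasSlade1993, §1.2, eq. (1.2.10)] -/
theorem one_le_count_mul_pow (n : ℕ) :
    (1 : ℝ) ≤ (SAW.Zd.count 2 n : ℝ) * SAW.criticalFugacity ^ n := by
  have hμ : 0 < SAW.Zd.connectiveConstant 2 := SAW.Zd.connectiveConstant_pos 2
  have h := SAW.Zd.pow_connectiveConstant_le_count 2 n
  have hx : SAW.criticalFugacity = (SAW.Zd.connectiveConstant 2)⁻¹ := by
    rw [← SAW.Zd.criticalPoint_two]; rfl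
  rw [hx, inv_pow]
  rw [le_mul_inv_iff₀ (pow_pos hμ n), one_mul]
  exact h

/-- Exchange of a triangular double sum against a product of partial sums (nonnegative terms):
`Σ_{n ≤ M} Σ_{m ≤ n} F(m+1) G(n-m) ≤ (Σ_{j ≤ M+1} F j) (Σ_{k ≤ M} G k)`. [folklore] -/
theorem triangle_sum_le (F G : ℕ → ℝ) (hF : ∀ n, 0 ≤ F n) (hG : ∀ n, 0 ≤ G n) (M : ℕ) :
    ∑ n ∈ Finset.range (M + 1), ∑ m ∈ Finset.range (n + 1), F (m + 1) * G (n - m) ≤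
      (∑ j ∈ Finset.range (M + 2), F j) * ∑ k ∈ Finset.range (M + 1), G k := by
  have hswap : ∑ n ∈ Finset.range (M + 1), ∑ m ∈ Finset.range (n + 1), F (m + 1) * G (n - m) =
      ∑ m ∈ Finset.range (M + 1), ∑ n ∈ Finset.Ico m (M + 1), F (m + 1) * G (n - m) := by
    refine Finset.sum_comm' fun n m => ?_
    simp only [Finset.mem_range, Finset.mem_Ico]
    omega
  rw [hswap]
  have hGsum : 0 ≤ ∑ k ∈ Finset.range (M + 1), G k := Finset.sum_nonneg fun k _ => hG k
  calc ∑ m ∈ Finset.range (M + 1), ∑ n ∈ Finset.Ico m (M + 1), F (m + 1) * G (n - m)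
      = ∑ m ∈ Finset.range (M + 1), F (m + 1) * ∑ k ∈ Finset.range (M + 1 - m), G k := by
        refine Finset.sum_congr rfl fun m _ => ?_
        rw [Finset.mul_sum, Finset.sum_Ico_eq_sum_range]
        refine Finset.sum_congr rfl fun k _ => ?_
        rw [Nat.add_sub_cancel_left]
    _ ≤ ∑ m ∈ Finset.range (M + 1), F (m + 1) * ∑ k ∈ Finset.range (M + 1), G k := by
        refine Finset.sum_le_sum fun m _ => mul_le_mul_of_nonneg_left ?_ (hF _)
        exact Finset.sum_le_sum_of_subset_of_nonneg (Finset.range_mono (Nat.sub_le (M + 1) m))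
          fun k _ _ => hG k
    _ = (∑ m ∈ Finset.range (M + 1), F (m + 1)) * ∑ k ∈ Finset.range (M + 1), G k := by
        rw [Finset.sum_mul]
    _ ≤ (∑ j ∈ Finset.range (M + 2), F j) * ∑ k ∈ Finset.range (M + 1), G k := by
        refine mul_le_mul_of_nonneg_right ?_ hGsum
        rw [Finset.sum_range_succ' F (M + 1)]
        linarith [hF 0]

/-- `Σ_{n ≤ M} c_n x_c^n ≤ x_c⁻¹ · H_{M+1} · H_M` (Madras–Slade (3.1.7)/(3.1.12): cut at the last
minimum of the first coordinate). [cite: MadrasSlade1993, §3.1, eq. (3.1.12)] -/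
theorem sum_count_mul_pow_le (M : ℕ) :
    ∑ n ∈ Finset.range (M + 1), (SAW.Zd.count 2 n : ℝ) * SAW.criticalFugacity ^ n ≤
      SAW.criticalFugacity⁻¹ * (halfPlanePartialSum (M + 1) * halfPlanePartialSum M) := by
  set x := SAW.criticalFugacity with hxdef
  have hx : 0 < x := criticalFugacity_pos
  set F : ℕ → ℝ := fun j => (SAW.Zd.halfSpaceCount 2 j : ℝ) * x ^ j with hF
  have hF0 : ∀ j, 0 ≤ F j := fun j => mul_nonneg (Nat.cast_nonneg _) (pow_nonneg hx.le _)
  -- termwise: c_n x^n ≤ x⁻¹ Σ_m F(m+1) F(n-m)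
  have hterm : ∀ n, (SAW.Zd.count 2 n : ℝ) * x ^ n ≤
      x⁻¹ * ∑ m ∈ Finset.range (n + 1), F (m + 1) * F (n - m) := by
    intro n
    have hc : (SAW.Zd.count 2 n : ℝ) ≤
        ∑ m ∈ Finset.range (n + 1), (SAW.Zd.halfSpaceCount 2 (m + 1) : ℝ) *
          (SAW.Zd.halfSpaceCount 2 (n - m) : ℝ) := by
      exact_mod_cast SAW.Zd.count_le_sum_halfSpaceCount (d := 2) n
    calc (SAW.Zd.count 2 n : ℝ) * x ^ n
        ≤ (∑ m ∈ Finset.range (n + 1), (SAW.Zd.halfSpaceCount 2 (m + 1) : ℝ) *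
            (SAW.Zd.halfSpaceCount 2 (n - m) : ℝ)) * x ^ n :=
          mul_le_mul_of_nonneg_right hc (pow_nonneg hx.le n)
      _ = x⁻¹ * ∑ m ∈ Finset.range (n + 1), F (m + 1) * F (n - m) := by
          rw [Finset.sum_mul, Finset.mul_sum]
          refine Finset.sum_congr rfl fun m hm => ?_
          rw [Finset.mem_range] at hm
          have hpow : x ^ (m + 1) * x ^ (n - m) = x ^ n * x := by
            rw [← pow_add, show m + 1 + (n - m) = n + 1 by omega, pow_succ]
          simp only [hF]
          field_simp
          rw [mul_assoc, mul_assoc, ← hpow]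
          ring
  calc ∑ n ∈ Finset.range (M + 1), (SAW.Zd.count 2 n : ℝ) * x ^ n
      ≤ ∑ n ∈ Finset.range (M + 1), x⁻¹ * ∑ m ∈ Finset.range (n + 1), F (m + 1) * F (n - m) :=
        Finset.sum_le_sum fun n _ => hterm n
    _ = x⁻¹ * ∑ n ∈ Finset.range (M + 1), ∑ m ∈ Finset.range (n + 1), F (m + 1) * F (n - m) := by
        rw [Finset.mul_sum]
    _ ≤ x⁻¹ * ((∑ j ∈ Finset.range (M + 2), F j) * ∑ k ∈ Finset.range (M + 1), F k) :=
        mul_le_mul_of_nonneg_left (triangle_sum_le F F hF0 hF0 M) (inv_nonneg.2 hx.le)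
    _ = x⁻¹ * (halfPlanePartialSum (M + 1) * halfPlanePartialSum M) := rfl

/-- **The half-plane generating function diverges at `x_c`**: its partial sums are unbounded
(Madras–Slade Corollary 3.1.8, `H(z_c) = ∞`, finitary form). [cite: MadrasSlade1993, Corollary 3.1.8] -/
theorem halfPlanePartialSum_unbounded (B : ℝ) : ∃ K, B < halfPlanePartialSum K := by
  by_contra! h
  have hx : 0 < SAW.criticalFugacity := criticalFugacity_pos
  have hB : 0 ≤ B := (halfPlanePartialSum_nonneg 0).trans (h 0)
  -- `M + 1 ≤ Σ_{n ≤ M} c_n x_c^n ≤ x_c⁻¹ B²` for every `M`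
  have key : ∀ M : ℕ, (M : ℝ) + 1 ≤ SAW.criticalFugacity⁻¹ * (B * B) := by
    intro M
    calc (M : ℝ) + 1 = ∑ n ∈ Finset.range (M + 1), (1 : ℝ) := by simp
      _ ≤ ∑ n ∈ Finset.range (M + 1), (SAW.Zd.count 2 n : ℝ) * SAW.criticalFugacity ^ n :=
          Finset.sum_le_sum fun n _ => one_le_count_mul_pow n
      _ ≤ SAW.criticalFugacity⁻¹ * (halfPlanePartialSum (M + 1) * halfPlanePartialSum M) :=
          sum_count_mul_pow_le M
      _ ≤ SAW.criticalFugacity⁻¹ * (B * B) := by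
          refine mul_le_mul_of_nonneg_left ?_ (inv_nonneg.2 hx.le)
          exact mul_le_mul (h _) (h _) (halfPlanePartialSum_nonneg _) hB
  obtain ⟨M, hM⟩ := exists_nat_gt (SAW.criticalFugacity⁻¹ * (B * B))
  linarith [key M]

end

end Summit.CriticalPhenomena.SAWScalingLimit.Theorems.AnnularMassDecay.Negative
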